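import Summits.ResolutionOfSingularities.ResolutionOfSingularities.Theorems.EquisingularLiftEquisingularLiftNatNodalCurveCartier
import HarnessLib

/-!
# [OURS · L1 W4.5(b) · EL♮(3) · WIDTH TABLE D8, support debt S-D8-LIFT, brick (N-C1 (b′))] THE lci CLAUSE OF (F) FOR THE NODAL RESIDUE WITH ONLY `Z̃`
# QUASI-COMPACT — the twin of ✓ `NodalCurve.exists_affineOpens_isWeaklyRegular_ker` asked by res-L1-w45b-stub-4 g14 for the (C6) assembly

res-L1-w45b-nose-w1 g5 (WIDTH seat D-0157 DOOR 1; S-D8-LIFT second pen; ask on the bus 2026-08-29T04:52:15Z).  OURS; NOT a statement of any manuscript;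
AI-written, weaker than expert review.  No `sorry`; standard axioms; DEF-FREE.  `--supports stmt-ResolutionOfSingularities-20148 --as helper`, counted 0.
EL♮(3) is NOT proved; resolution of singularities in positive characteristic is NOT proved.

WHY.  ✓ p696215 `NodalCurve.exists_affineOpens_isWeaklyRegular_ker` (…NatNodalCurveCartier) carries `[CompactSpace G]`, but the residue
`NodalCurveLiftAt` (like F-88's `EmbeddedCurveLiftAt`) only makes `V(𝓔)` proper over `O` — so the special fibre `Ẽ` and its closed subscheme `Z̃`
are quasi-compact, NOT the ambient special fibre `G` of an arbitrary stage.  The proof used compactness only through `CompactSpace Z̃` (closed points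
of `Z̃` suffice), so here is the twin with exactly that hypothesis; everything else byte-identical (a new module because the parent file is at the
400-line bound).

WHAT.  ★★ `NodalCurve.exists_affineOpens_isWeaklyRegular_ker'` — as ✓ `…_ker` with `[CompactSpace G]` REPLACED by `[CompactSpace ↥(redSub G Z hZ)]`
(placed after `hZ hE`): `∀ z : Z̃, ∃ U : Ẽ.affineOpens, i z ∈ U ∧ ∃ rs, IsWeaklyRegular Γ(Ẽ, U) rs ∧ Ideal.ofList rs = (ker i)(U)`.
-/

set_option linter.dupNamespace false -- mandated namespace `Summit.<Summit>.<Problem>` of this single-conjunct summit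

noncomputable section

open CategoryTheory AlgebraicGeometry TopologicalSpace IsLocalRing
open Literature.AlgebraicGeometry.Resolution
open AlgebraicGeometry.Scheme.IdealSheafData

namespace Summit.ResolutionOfSingularities.ResolutionOfSingularities.Cruxes.EquisingularLiftNat.Sections.NodalCurve

/-- ★★ **(N-C1 (b′)) THE lci CLAUSE OF (F), with only `Z̃` QUASI-COMPACT** (res-L1-w45b-stub-4's (C6) currency: the residue gives `V(𝓔)` proper over
`O`, hence `Z̃` compact, but not the ambient special fibre `G`): under (D1), (D2) and «`Ẽ` regular along `Z̃`» (with `G` locally Noetherian and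
`Z̃` quasi-compact), every point of `Z̃` has an affine open neighbourhood `U` in `Ẽ` on which the ideal of `Z̃` is generated by ONE NON-ZERO-DIVISOR
`j ∈ Γ(Ẽ, U)` — i.e. by the weakly regular sequence `[j]`, F-88's `EmbeddedLiftFact` clause VERBATIM in shape.  (Closed points suffice since open
sets are stable under generisation; at a closed point, (a) gives a generator of the stalk ideal, which is spread — generator AND non-zero-divisor —
to a basic open neighbourhood by Noetherian finiteness.) [folklore; every characteristic] -/
theorem exists_affineOpens_isWeaklyRegular_ker' {G : Scheme.{0}} [IsLocallyNoetherian G]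
    {Z E : Set G} (hZ : IsClosed Z) (hE : IsClosed E) [CompactSpace ↥(redSub G Z hZ)]
    (i : redSub G Z hZ ⟶ redSub G E hE) (hi : i ≫ redSubι G E hE = redSubι G Z hZ)
    (hEreg : ∀ x : ↥(redSub G Z hZ), IsRegularLocalRing ((redSub G E hE).presheaf.stalk (i x)))
    (hEdim : ∀ z : ↥(redSub G Z hZ), IsClosed ({z} : Set ↥(redSub G Z hZ)) →
      ringKrullDim ((redSub G E hE).presheaf.stalk (i z)) = ((2 : ℕ) : WithBot ℕ∞))
    (hZdim : ∀ z : ↥(redSub G Z hZ), IsClosed ({z} : Set ↥(redSub G Z hZ)) →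
      ringKrullDim ((redSub G Z hZ).presheaf.stalk z) = ((1 : ℕ) : WithBot ℕ∞)) :
    ∀ z : ↥(redSub G Z hZ), ∃ U : (redSub G E hE).affineOpens, i.base z ∈ (U : (redSub G E hE).Opens) ∧
      ∃ rs : List Γ(redSub G E hE, U), RingTheory.Sequence.IsWeaklyRegular Γ(redSub G E hE, U) rs ∧ Ideal.ofList rs = i.ker.ideal U := by
  classical
  haveI : IsClosedImmersion (i ≫ redSubι G E hE) := by rw [hi]; infer_instance
  haveI : IsClosedImmersion i := IsClosedImmersion.of_comp_isClosedImmersion i (redSubι G E hE)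
  haveI : IsLocallyNoetherian (redSub G E hE) := LocallyOfFiniteType.isLocallyNoetherian (redSubι G E hE)
  -- closed points suffice (`Z̃` quasi-compact)
  suffices hcl : ∀ z₀ : ↥(redSub G Z hZ), IsClosed ({z₀} : Set ↥(redSub G Z hZ)) →
      ∃ U : (redSub G E hE).affineOpens, i.base z₀ ∈ (U : (redSub G E hE).Opens) ∧
        ∃ rs : List Γ(redSub G E hE, U), RingTheory.Sequence.IsWeaklyRegular Γ(redSub G E hE, U) rs ∧ Ideal.ofList rs = i.ker.ideal U by
    intro z
    obtain ⟨z₀, hz₀, hcl₀⟩ := (isClosed_closure (s := ({z} : Set ↥(redSub G Z hZ)))).exists_closed_singleton ⟨z, subset_closure rfl⟩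
    have hzz₀ : z ⤳ z₀ := specializes_iff_mem_closure.mpr hz₀
    obtain ⟨U, hU, rs, hrs⟩ := hcl z₀ hcl₀
    exact ⟨U, (hzz₀.map i.continuous).mem_open U.1.isOpen hU, rs, hrs⟩
  intro z₀ hz₀
  -- (a) at the closed point
  obtain ⟨f, hf0, hf⟩ := exists_stalkIdeal_ker_eq_span_singleton hZ hE i hi hEreg hEdim hZdim z₀ hz₀
  haveI := hEreg z₀
  haveI := isDomain_of_isRegularLocalRing ((redSub G E hE).presheaf.stalk (i z₀))
  -- an affine open neighbourhood `U₀`, its (Noetherian) ring `R`, the prime `𝔮` of `i z₀`, and the stalk as `R_𝔮`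
  obtain ⟨U₀, hU₀, hxU₀, -⟩ := exists_isAffineOpen_mem_and_subset (X := redSub G E hE) (x := i z₀) (U := ⊤) (Opens.mem_top _)
  letI := TopCat.Presheaf.algebra_section_stalk (redSub G E hE).presheaf (⟨i z₀, hxU₀⟩ : (U₀ : (redSub G E hE).Opens))
  haveI := hU₀.isLocalization_stalk ⟨i z₀, hxU₀⟩
  set 𝔮 := (hU₀.primeIdealOf ⟨i z₀, hxU₀⟩).asIdeal with h𝔮
  have halg : ∀ a : Γ(redSub G E hE, U₀), algebraMap Γ(redSub G E hE, U₀) ((redSub G E hE).presheaf.stalk (i z₀)) a =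
      ((redSub G E hE).presheaf.germ U₀ (i z₀) hxU₀).hom a := fun a => rfl
  set J : Ideal Γ(redSub G E hE, U₀) := i.ker.ideal ⟨U₀, hU₀⟩ with hJ
  -- the stalk ideal is `J · R_𝔮 = (f)`; pick `j ∈ J` whose germ generates it
  have hJf : J.map (algebraMap Γ(redSub G E hE, U₀) ((redSub G E hE).presheaf.stalk (i z₀))) = Ideal.span {f} := by
    rw [← hf, stalkIdeal_eq_map_germ i.ker ⟨U₀, hU₀⟩ hxU₀]; rfl
  obtain ⟨s, ⟨j, hjJ, rfl⟩, hsj⟩ := exists_mem_span_singleton_eq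
    (S := ⇑(algebraMap Γ(redSub G E hE, U₀) ((redSub G E hE).presheaf.stalk (i z₀))) '' (J : Set Γ(redSub G E hE, U₀))) hf0
    (by rw [← hJf]; rfl)
  have hjJ' : j ∈ J := hjJ
  have hj0 : algebraMap Γ(redSub G E hE, U₀) ((redSub G E hE).presheaf.stalk (i z₀)) j ≠ 0 := by
    intro h0; apply hf0
    rw [← Ideal.span_singleton_eq_bot, ← hsj, Ideal.span_singleton_eq_bot]; exact h0
  -- spread the generator: `g₁ ∉ 𝔮` with `g₁ x ∈ jR` for `x ∈ J`
  have hJle : J.map (algebraMap Γ(redSub G E hE, U₀) ((redSub G E hE).presheaf.stalk (i z₀))) ≤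
      Ideal.span {algebraMap Γ(redSub G E hE, U₀) ((redSub G E hE).presheaf.stalk (i z₀)) j} := by
    rw [hJf, ← hsj]
  haveI : IsNoetherianRing Γ(redSub G E hE, U₀) := IsLocallyNoetherian.component_noetherian ⟨U₀, hU₀⟩
  obtain ⟨g₁, hg₁, H₁⟩ := Literature.RingTheory.UniqueFactorizationDomain.exists_notMem_forall_mul_mem_of_fg (q := 𝔮)
    (IsNoetherian.noetherian J) (Literature.RingTheory.UniqueFactorizationDomain.exists_mul_eq_of_map_le_span hJle)
  -- spread the non-zero-divisor: `g₂ ∉ 𝔮` killing the annihilator of `j`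
  obtain ⟨g₂, hg₂, H₂⟩ := exists_notMem_forall_mul_eq_zero 𝔮 (A := (redSub G E hE).presheaf.stalk (i z₀)) hj0
  -- the basic open `D(g₁ g₂) ∋ i z₀`
  have hgq : g₁ * g₂ ∉ 𝔮 := fun h => ((inferInstance : 𝔮.IsPrime).mem_or_mem h).elim hg₁ hg₂
  have hxg : (i z₀ : ↥(redSub G E hE)) ∈ (redSub G E hE).basicOpen (g₁ * g₂) := by
    rw [(redSub G E hE).mem_basicOpen (g₁ * g₂) (i z₀) hxU₀]
    exact (IsLocalization.AtPrime.isUnit_to_map_iff ((redSub G E hE).presheaf.stalk (i z₀)) 𝔮 (g₁ * g₂)).mpr hgq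
  haveI := hU₀.isLocalization_basicOpen (g₁ * g₂)
  refine ⟨(redSub G E hE).affineBasicOpen (U := ⟨U₀, hU₀⟩) (g₁ * g₂), hxg,
    [algebraMap Γ(redSub G E hE, U₀) Γ(redSub G E hE, (redSub G E hE).basicOpen (g₁ * g₂)) j], ?_, ?_⟩
  · -- `[j]` is weakly regular on `Γ(D(g₁ g₂))`: `j` is a non-zero-divisor there
    show RingTheory.Sequence.IsWeaklyRegular Γ(redSub G E hE, (redSub G E hE).basicOpen (g₁ * g₂))
      [algebraMap Γ(redSub G E hE, U₀) Γ(redSub G E hE, (redSub G E hE).basicOpen (g₁ * g₂)) j]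
    rw [RingTheory.Sequence.isWeaklyRegular_singleton_iff]
    exact isSMulRegular_algebraMap_of_away (g := g₁ * g₂) (fun a ha => by rw [mul_assoc, H₂ a ha, mul_zero])
  · -- `(ker i)(D(g₁ g₂)) = J · Γ(D(g₁ g₂)) = (j)`
    have hunit : IsUnit (algebraMap Γ(redSub G E hE, U₀) Γ(redSub G E hE, (redSub G E hE).basicOpen (g₁ * g₂)) (g₁ * g₂)) :=
      IsLocalization.Away.algebraMap_isUnit (g₁ * g₂)
    have hmap := map_eq_span_singleton_of_forall_mul_eq hjJ' (fun x hx => by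
      obtain ⟨a, ha⟩ := H₁ x hx
      exact ⟨g₂ * a, by rw [mul_assoc, mul_comm g₂ x, ← mul_assoc, ha]; ring⟩) hunit
    have h3 := i.ker.map_ideal_basicOpen ⟨U₀, hU₀⟩ (g₁ * g₂)
    show Ideal.ofList [algebraMap Γ(redSub G E hE, U₀) Γ(redSub G E hE, (redSub G E hE).basicOpen (g₁ * g₂)) j] =
      i.ker.ideal ((redSub G E hE).affineBasicOpen (U := ⟨U₀, hU₀⟩) (g₁ * g₂))
    rw [Ideal.ofList_singleton]
    exact hmap.symm.trans h3

end Summit.ResolutionOfSingularities.ResolutionOfSingularities.Cruxes.EquisingularLiftNat.Sections.NodalCurve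

end
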